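import Literature.NumberTheory.Sieve.SieveFunctionsBridge
import Literature.NumberTheory.Sieve.DelayEquationDecay
import Literature.NumberTheory.Sieve.SieveFunctionsAdjoint
import Literature.NumberTheory.Sieve.SieveFunctionsConstruction
import HarnessLib

/-!
# The `β`-sieve functions exist: proof of the named fact `exists_isBetaSieveData`

Trunk `AntSieve`; companion to `Literature.NumberTheory.Sieve.SieveFunctions` (item
`provefact Literature.exists_isBetaSieveData`). Everything in this file is proved:
`exists_isBetaSieveData_holds : exists_isBetaSieveData` with the standard axioms only.

## The argument (Iwaniec 1980, §§3–4; Greaves, *Sieves in Number Theory*, §4.2; Diamond–Halberstam–Galway, *A Higher-Dimensional Sieve Method*, Ch. 12)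

Fix `κ ≥ 1/2`. A parameter `β ≥ 1` is *admissible* if the Rosser–Iwaniec system of dimension `κ`
has a continuous solution `(F, f)` on `(0, ∞)` with `F(s) = A s^{−κ}` on `(0, β + 1]`, `f = 0` on
`(0, β]`, `A > 0`, normalised by `F, f = 1 + O(e^{−s})` (`IsBetaSieveSolution`).

* SUFFICIENCY (`BetaSieveForward.isBetaSieveSolution_fwd`). For `β ≥ 1` (and `κ < 1` if `β = 1`)
  the forward solution `(fwdUpper, fwdLower)` of `SieveFunctionsConstruction` solves everything but
  the normalisation, for every `A`. Put `P = F + f = s^{−κ} w₊`, `Q = F − f = s^{−κ} w₋`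
  (`w_± = delaySol β (±1) A k_κ`). Iwaniec's inner products `⟨P, p_κ⟩_{−κ}` and `⟨Q, q_κ⟩_κ`
  (`sieveInnerProduct` of `SieveAdjoint`, with `p_κ = rosserAdjointP κ` of `SieveAdjointP` and
  `q_κ = qFun κ` of `SieveFunctionsAdjoint`) have derivative `0` on `(β, ∞)`
  (`hasDerivAt_innerProduct_fwd`, Greaves Lemma 4.2.1 (i)) and are continuous on `[β, ∞)` — also
  at `β = 1`, where the integrand has the integrable singularity `x^{−κ}` at `0`
  (`continuousOn_innerProduct_fwd`) — hence constant (`innerProduct_fwd_eq`), with the values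
  `A · C_P`, `A · C_Q` at `β` (`innerProduct_fwd_beta`; `C_Q = (β − 1)^{1−κ} q_κ(β − 1)` for
  `β > 1`, `boundaryConst_lower_eq`, Greaves (4.2.4.7)). If `C_Q = 0` and `A = 2/C_P` (`C_P > 0`,
  `boundaryConst_upper_pos`; this is Greaves's `C = 2(β − 1)^{κ−1}/p(β − 1)`, Lemma 4.2.5), then
  `⟨Q, q_κ⟩ ≡ 0` and `⟨P, p_κ⟩ ≡ 2 = ⟨2, p_κ⟩` (`sieveInnerProduct_two_p`, Diamond–Halberstam–Galway
  (12.15)); since `p_κ` is positive decreasing and `q_κ(x+1) ≤ M q_κ(s)` on `[s − 1, s]` for large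
  `s`, the de Bruijn–Hua lemma (`isBigO_exp_neg_of_delay_ineq` of `DelayEquationDecay`) gives
  `P − 2, Q = O(e^{−s})` (`isBigO_of_innerProduct_p_eq_two`, `isBigO_of_innerProduct_q_eq_zero`;
  Diamond–Halberstam–Galway §12.2, Greaves Lemma 4.2.6), i.e. the normalisation.
* EXISTENCE (`BetaSieveForward.exists_isBetaSieveSolution`). For `κ > 1/2`, `q_κ` has a positive zero `ρ`
  (`exists_zero_qFun`, Greaves Lemma 4.2.3 (ii)) and `β = 1 + ρ` has `C_Q = 0`
  (`exists_isBetaSieveSolution_of_qFun_eq_zero`); for `κ = 1/2`, `β = 1` and `q_{1/2} = 1` give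
  `C_Q = 1 − ½ ∫_0^1 x^{−1/2} dx = 0` (`exists_isBetaSieveSolution_half`, Greaves Lemma 4.2.5 (ii)).
* NECESSITY and FINITENESS (`finite_setOf_isBetaSieveSolution`). An admissible `β > 1` has
  `q_κ(β − 1) = 0` (`IsBetaSieveSolution.adjoint_apply_eq_zero` of `SieveAdjoint`), and `q_κ` has
  finitely many positive zeros (`finite_zeros_qFun`,
  Greaves Lemma 4.2.3 (i)); so the admissible set lies in `{1} ∪ (1 + Z(q_κ))` and is finite.
* `exists_isBetaSieveData_holds`: a nonempty finite set of reals has a least element; a normalised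
  solution at the least admissible `β` is `IsBetaSieveData`.

## Corollaries

* `exists_isGreatestBetaSieveData_holds : exists_isGreatestBetaSieveData` — the named fact of the
  "Correction (2026-08-14)" section of `SieveFunctions.lean` (Iwaniec's data pinned by the GREATEST
  admissible `β`): a nonempty finite set also has a greatest element. With it the conditional lemmas
  of `SieveFunctionsBridge` become unconditional: `iwaniecSiftingLimit_half_holds`,
  `siftingLimit_le_iwaniecSiftingLimit'`, `isGreatestBetaSieveData_greatestBetaSieveData'`; and
  `iwaniecSiftingLimit_three_halves_eq : iwaniecSiftingLimit (3/2) = (5 + √3)/2` settles the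
  disjunction left open there. (`β_1 = 2` for both pins is `LinearSieveExistence.lean`.)
* `siftingLimit_half : siftingLimit (1/2) = 1`, `isBetaSieveData_betaSieveData'`,
  `BetaSieveFunctions.nonempty'` (unconditional).
* `siftingLimit_three_halves : siftingLimit (3/2) = (5 − √3)/2` and
  `siftingLimit_three_halves_lt : siftingLimit (3/2) < iwaniecSiftingLimit (3/2)` — the expectation
  stated (as a heuristic, with numerical support) in the Correction section of `SieveFunctions.lean`
  is a theorem: the normalised system IS solvable at every positive zero of `q_κ`
  (`exists_isBetaSieveSolution_of_qFun_eq_zero`), so for `κ = 3/2` the least admissible `β`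
  (`1.6339…`) is not Iwaniec's `β_{3/2} = 3.3660…`.

## References

* H. Iwaniec, *Rosser's sieve*, Acta Arith. 36 (1980), 171–202, §§3–4.
* G. Greaves, *Sieves in Number Theory*, Springer 2001, §4.2: Proposition 4.2.1, Lemma 4.2.1,
  Lemma 4.2.3, (4.2.4.1)–(4.2.4.11), Lemmas 4.2.5–4.2.7.
* H. G. Diamond, H. Halberstam, W. F. Galway, *A Higher-Dimensional Sieve Method*, CUP 2008,
  §§12.1–12.2 ((12.15), (12.18)–(12.19), Lemma 12.1), §15.3 (Tables 15.1–15.3).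
-/

open Filter Asymptotics Set MeasureTheory intervalIntegral

noncomputable section

namespace Literature.NumberTheory.Sieve

open SieveAdjoint BetaSieveForward

/-! ### Calculus helpers -/

/-- A function continuous on `[a, b]` with derivative `0` on `(a, b)` takes the same value at the
endpoints (mean value theorem). [folklore] -/
theorem eq_of_hasDerivAt_zero_Ioo {g : ℝ → ℝ} {a b : ℝ} (hab : a < b)
    (hcont : ContinuousOn g (Icc a b)) (hderiv : ∀ x ∈ Ioo a b, HasDerivAt g 0 x) :
    g b = g a := by
  obtain ⟨c, -, hc⟩ := exists_hasDerivAt_eq_slope g (fun _ => (0 : ℝ)) hab hcont hderiv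
  have hba : b - a ≠ 0 := sub_ne_zero.mpr hab.ne'
  have : g b - g a = 0 := by
    have h := hc.symm
    rw [div_eq_zero_iff] at h
    exact h.resolve_right hba
  linarith

/-- Derivative of the sliding integral `u ↦ ∫_{u−1}^{u} g` at a point `s` such that `g` is
continuous on an open half-line containing `[s − 1, s]`. [folklore] -/
theorem hasDerivAt_integral_sub_one {g : ℝ → ℝ} {d s : ℝ} (hd : d < s - 1)
    (hg : ContinuousOn g (Ioi d)) :
    HasDerivAt (fun u => ∫ x in (u - 1)..u, g x) (g s - g (s - 1)) s := by
  have hint : ∀ a b, d < a → d < b → IntervalIntegrable g volume a b := by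
    intro a b ha hb
    refine (hg.mono ?_).intervalIntegrable
    intro x hx
    simp only [mem_Ioi]
    rcases le_total a b with hab | hab
    · rw [uIcc_of_le hab] at hx; exact lt_of_lt_of_le ha hx.1
    · rw [uIcc_of_ge hab] at hx; exact lt_of_lt_of_le hb hx.1
  have hmeas : ∀ x, d < x → StronglyMeasurableAtFilter g (nhds x) volume := fun x hx =>
    hg.stronglyMeasurableAtFilter isOpen_Ioi x hx
  have hcts : ∀ x, d < x → ContinuousAt g x := fun x hx =>
    hg.continuousAt (Ioi_mem_nhds hx)
  have hs : d < s := by linarith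
  -- `u ↦ ∫_{s}^{u} g` and `u ↦ ∫_{s}^{u-1} g`
  have h1 : HasDerivAt (fun u => ∫ x in s..u, g x) (g s) s :=
    intervalIntegral.integral_hasDerivAt_right (hint s s hs hs) (hmeas s hs) (hcts s hs)
  have h2' : HasDerivAt (fun v => ∫ x in s..v, g x) (g (s - 1)) (s - 1) :=
    intervalIntegral.integral_hasDerivAt_right (hint s (s - 1) hs hd) (hmeas _ hd) (hcts _ hd)
  have h2 : HasDerivAt (fun u => ∫ x in s..(u - 1), g x) (g (s - 1)) s := by
    have hsub : HasDerivAt (fun u : ℝ => u - 1) 1 s := (hasDerivAt_id s).sub_const 1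
    have hc : HasDerivAt ((fun v => ∫ x in s..v, g x) ∘ fun u : ℝ => u - 1) (g (s - 1) * 1) s :=
      HasDerivAt.comp s h2' hsub
    simpa [Function.comp_def] using hc
  have heq : (fun u => ∫ x in (u - 1)..u, g x) =ᶠ[nhds s]
      fun u => (∫ x in s..u, g x) - ∫ x in s..(u - 1), g x := by
    filter_upwards [Ioi_mem_nhds (show d + 1 < s by linarith)] with u hu
    rw [intervalIntegral.integral_interval_sub_left (hint _ _ hs (by linarith [mem_Ioi.mp hu]))
      (hint _ _ hs (by linarith [mem_Ioi.mp hu]))]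
  exact ((h1.sub h2).congr_of_eventuallyEq heq)

/-- **The inner product is locally constant** (Greaves, *Sieves in Number Theory*, Lemma 4.2.1 (i),
(4.2.2.8)–(4.2.2.9); Diamond–Halberstam–Galway §12.1), pointwise form for `sieveInnerProduct` of
`SieveAdjoint`: if at the point `s` the function `R` has derivative `R'` with
`s R' = −a R(s) − b R(s−1)`, `t ↦ t r(t)` has derivative `a r(s) + b r(s+1)`, and
`x ↦ r(x+1) R(x)` is continuous on an open half-line containing `[s − 1, s]`, then `⟨R, r⟩_b` has
derivative `0` at `s`. [cite: Greaves2001, Lemma 4.2.1 (i)] -/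
theorem hasDerivAt_sieveInnerProduct {a b : ℝ} {R r : ℝ → ℝ} {R' s d : ℝ} (hd : d < s - 1)
    (hR : HasDerivAt R R' s) (hReq : s * R' = -a * R s - b * R (s - 1))
    (hr : HasDerivAt (fun t => t * r t) (a * r s + b * r (s + 1)) s)
    (hg : ContinuousOn (fun x => r (x + 1) * R x) (Ioi d)) :
    HasDerivAt (sieveInnerProduct b R r) 0 s := by
  have hI := hasDerivAt_integral_sub_one hd hg
  have hP : HasDerivAt (fun t => t * r t * R t) ((a * r s + b * r (s + 1)) * R s + s * r s * R') s :=
    hr.mul hR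
  have h := hP.sub (hI.const_mul b)
  have hfun : sieveInnerProduct b R r = fun t => t * r t * R t - b * ∫ x in (t - 1)..t, r (x + 1) * R x := by
    funext t; rfl
  rw [hfun]
  refine h.congr_deriv ?_
  have : s * r s * R' = r s * (s * R') := by ring
  rw [this, hReq]
  ring

/-- `x ↦ r(x + 1)` is continuous on `(0, ∞)` when `r` is. [folklore] -/
theorem continuousOn_comp_add_one {r : ℝ → ℝ} (hrc : ContinuousOn r (Ioi 0)) :
    ContinuousOn (fun x => r (x + 1)) (Ioi 0) :=
  hrc.comp (continuousOn_id.add continuousOn_const) fun x hx => by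
    simp only [mem_Ioi] at hx ⊢; linarith

namespace BetaSieveForward

/-! ### The engine: inner products of the forward combinations `s^{−κ} w(s)` -/

section Engine

variable {κ β A b c : ℝ} {w r : ℝ → ℝ}

/-- `s · s^{−κ−1} = s^{−κ}` for `s > 0`. [folklore] -/
theorem mul_rpow_neg_sub_one {s : ℝ} (hs : 0 < s) (κ : ℝ) : s * s ^ (-κ - 1) = s ^ (-κ) := by
  rw [Real.rpow_sub_one hs.ne', mul_div_cancel₀ _ hs.ne']

/-- `s · s^{−κ} · k_κ(s) = κ (s − 1)^{−κ}` for `s > 0`. [folklore] -/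
theorem mul_rpow_neg_mul_sieveKernel {s : ℝ} (hs : 0 < s) (κ : ℝ) :
    s * s ^ (-κ) * sieveKernel κ s = κ * (s - 1) ^ (-κ) := by
  simp only [sieveKernel]
  have h1 : s ^ (-κ) * s ^ (κ - 1) = s ^ (-1 : ℝ) := by
    rw [← Real.rpow_add hs]; congr 1; ring
  have h2 : s * s ^ (-1 : ℝ) = 1 := by rw [Real.rpow_neg_one, mul_inv_cancel₀ hs.ne']
  calc s * s ^ (-κ) * (κ * s ^ (κ - 1) * (s - 1) ^ (-κ))
      = κ * (s * (s ^ (-κ) * s ^ (κ - 1))) * (s - 1) ^ (-κ) := by ring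
    _ = κ * (s - 1) ^ (-κ) := by rw [h1, h2, mul_one]

/-- Derivative of `R(t) = t^{−κ} w(t)` at `s > 0`. [folklore] -/
theorem hasDerivAt_rpow_neg_mul {s : ℝ} (hs : 0 < s) {w' : ℝ} (hw : HasDerivAt w w' s) :
    HasDerivAt (fun t : ℝ => t ^ (-κ) * w t) (-κ * s ^ (-κ - 1) * w s + s ^ (-κ) * w') s :=
  (Real.hasDerivAt_rpow_const (Or.inl hs.ne')).mul hw

/-- **The retarded equation of `R = s^{−κ} w`**: if `w' = c k_κ(s) w(s − 1)` then
`s R'(s) = −κ R(s) − b R(s − 1)` with `b = −cκ` (Greaves (4.2.1.13): `c = 1` is `P`, `b = −κ`;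
`c = −1` is `Q`, `b = κ`). [cite: Greaves2001, (4.2.1.13)] -/
theorem retarded_eq {s : ℝ} (hs : 0 < s) (hbc : b + c * κ = 0) :
    s * (-κ * s ^ (-κ - 1) * w s + s ^ (-κ) * (c * (sieveKernel κ s * w (s - 1)))) =
      -κ * (s ^ (-κ) * w s) - b * ((s - 1) ^ (-κ) * w (s - 1)) := by
  have e1 := mul_rpow_neg_sub_one hs κ
  have e2 := mul_rpow_neg_mul_sieveKernel hs κ
  have hb : b = -(c * κ) := by linarith
  calc s * (-κ * s ^ (-κ - 1) * w s + s ^ (-κ) * (c * (sieveKernel κ s * w (s - 1))))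
      = -κ * (s * s ^ (-κ - 1)) * w s + c * (s * s ^ (-κ) * sieveKernel κ s) * w (s - 1) := by
        ring
    _ = -κ * (s ^ (-κ) * w s) - b * ((s - 1) ^ (-κ) * w (s - 1)) := by rw [e1, e2, hb]; ring

/-- `R = s^{−κ} w` is continuous on `(0, ∞)` for `w` continuous. [folklore] -/
theorem continuousOn_rpow_neg_mul (hwc : Continuous w) :
    ContinuousOn (fun t : ℝ => t ^ (-κ) * w t) (Ioi 0) :=
  (continuousOn_rpow_neg κ).mul hwc.continuousOn

/-- `x ↦ r(x + 1) R(x)` is continuous on `(0, ∞)`. [folklore] -/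
theorem continuousOn_integrand_fwd (hrc : ContinuousOn r (Ioi 0)) (hwc : Continuous w) :
    ContinuousOn (fun x => r (x + 1) * (x ^ (-κ) * w x)) (Ioi 0) :=
  (continuousOn_comp_add_one hrc).mul (continuousOn_rpow_neg_mul hwc)

/-- **Iwaniec's inner product of a forward combination has derivative `0` on `(β, ∞)`**
(Greaves, Lemma 4.2.1 (i); Diamond–Halberstam–Galway before (12.18)). [cite: Greaves2001, Lemma 4.2.1 (i)] -/
theorem hasDerivAt_innerProduct_fwd (hβ : 1 ≤ β) (hbc : b + c * κ = 0)
    (hrc : ContinuousOn r (Ioi 0))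
    (hrd : ∀ s : ℝ, 0 < s → HasDerivAt (fun t => t * r t) (κ * r s + b * r (s + 1)) s)
    (hwc : Continuous w)
    (hwd : ∀ s, β < s → HasDerivAt w (c * (sieveKernel κ s * w (s - 1))) s)
    {s : ℝ} (hs : β < s) :
    HasDerivAt (sieveInnerProduct b (fun t : ℝ => t ^ (-κ) * w t) r) 0 s := by
  have hs0 : 0 < s := by linarith
  exact hasDerivAt_sieveInnerProduct (a := κ) (d := 0) (by linarith)
    (hasDerivAt_rpow_neg_mul hs0 (hwd s hs)) (retarded_eq hs0 hbc) (hrd s hs0)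
    (continuousOn_integrand_fwd hrc hwc)

/-- `x ↦ x^{−κ}` is integrable on `[β − 1, T]`: trivially for `β > 1`, and for `β = 1` because
then `κ < 1` (Greaves (4.2.1.5)). [cite: Greaves2001, (4.2.1.5)] -/
theorem intervalIntegrable_rpow_neg (hβ : 1 ≤ β) (hκβ : β = 1 → κ < 1) {T : ℝ}
    (hT : β - 1 ≤ T) : IntervalIntegrable (fun x : ℝ => x ^ (-κ)) volume (β - 1) T := by
  rcases eq_or_lt_of_le hβ with h | h
  · exact intervalIntegral.intervalIntegrable_rpow' (by linarith [hκβ h.symm])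
  · refine ((continuousOn_rpow_neg κ).mono ?_).intervalIntegrable
    intro x hx
    rw [uIcc_of_le hT] at hx
    exact lt_of_lt_of_le (by linarith : (0 : ℝ) < β - 1) hx.1

/-- The integrand `r(x + 1) x^{−κ} w(x)` of the inner product is integrable on `[β − 1, T]`.
[folklore] -/
theorem intervalIntegrable_integrand_fwd (hβ : 1 ≤ β) (hκβ : β = 1 → κ < 1)
    (hrc : ContinuousOn r (Ioi 0)) (hwc : Continuous w) {T : ℝ} (hT : β - 1 ≤ T) :
    IntervalIntegrable (fun x => r (x + 1) * (x ^ (-κ) * w x)) volume (β - 1) T := by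
  have h1 : IntervalIntegrable (fun x : ℝ => x ^ (-κ) * w x) volume (β - 1) T :=
    (intervalIntegrable_rpow_neg hβ hκβ hT).mul_continuousOn hwc.continuousOn
  refine h1.continuousOn_mul ?_
  refine hrc.comp (continuousOn_id.add continuousOn_const) fun x hx => ?_
  rw [uIcc_of_le hT] at hx
  show 0 < x + 1
  linarith [hx.1]

/-- The inner product of a forward combination is continuous on `[β, T]` (also at `β = 1`,
where the integrand has an integrable singularity at `0`). [folklore] -/
theorem continuousOn_innerProduct_fwd (hβ : 1 ≤ β) (hκβ : β = 1 → κ < 1)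
    (hrc : ContinuousOn r (Ioi 0)) (hwc : Continuous w) (T : ℝ) :
    ContinuousOn (sieveInnerProduct b (fun t : ℝ => t ^ (-κ) * w t) r) (Icc β T) := by
  set g : ℝ → ℝ := fun x => r (x + 1) * (x ^ (-κ) * w x) with hg
  have hgi : ∀ T', β - 1 ≤ T' → IntervalIntegrable g volume (β - 1) T' := fun T' hT' =>
    intervalIntegrable_integrand_fwd hβ hκβ hrc hwc hT'
  have hprim : ContinuousOn (fun u => ∫ x in (β - 1)..u, g x) (Icc (β - 1) T) := by
    rcases le_or_gt (β - 1) T with hT | hT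
    · have := intervalIntegral.continuousOn_primitive_interval' (hgi T hT) left_mem_uIcc
      rwa [uIcc_of_le hT] at this
    · rw [Icc_eq_empty (not_le.mpr hT)]
      exact continuousOn_empty _
  have h1 : ContinuousOn (fun s => s * r s * (s ^ (-κ) * w s)) (Icc β T) :=
    ((continuousOn_id.mul hrc).mul (continuousOn_rpow_neg_mul hwc)).mono
      fun x hx => show (0 : ℝ) < x by linarith [hx.1]
  have h2 : ContinuousOn (fun s => ∫ x in (s - 1)..s, g x) (Icc β T) := by
    have hA : ContinuousOn (fun s => ∫ x in (β - 1)..s, g x) (Icc β T) :=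
      hprim.mono (Icc_subset_Icc (by linarith) le_rfl)
    have hB : ContinuousOn (fun s => ∫ x in (β - 1)..(s - 1), g x) (Icc β T) :=
      hprim.comp (continuousOn_id.sub continuousOn_const) fun s hs =>
        ⟨by linarith [hs.1], by linarith [hs.2]⟩
    refine (hA.sub hB).congr fun s hs => ?_
    exact (intervalIntegral.integral_interval_sub_left (hgi s (by linarith [hs.1]))
      (hgi (s - 1) (by linarith [hs.1]))).symm
  have heq : sieveInnerProduct b (fun t : ℝ => t ^ (-κ) * w t) r =
      fun s => s * r s * (s ^ (-κ) * w s) - b * ∫ x in (s - 1)..s, g x := by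
    funext s
    simp only [sieveInnerProduct, hg]
  rw [heq]
  exact h1.sub (continuousOn_const.mul h2)

/-- **The inner product of a forward combination is constant on `[β, ∞)`** (Greaves,
Lemma 4.2.1 (i); Diamond–Halberstam–Galway (12.18)–(12.19)). [cite: Greaves2001, Lemma 4.2.1 (i)] -/
theorem innerProduct_fwd_eq (hβ : 1 ≤ β) (hκβ : β = 1 → κ < 1) (hbc : b + c * κ = 0)
    (hrc : ContinuousOn r (Ioi 0))
    (hrd : ∀ s : ℝ, 0 < s → HasDerivAt (fun t => t * r t) (κ * r s + b * r (s + 1)) s)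
    (hwc : Continuous w)
    (hwd : ∀ s, β < s → HasDerivAt w (c * (sieveKernel κ s * w (s - 1))) s)
    {s : ℝ} (hs : β ≤ s) :
    sieveInnerProduct b (fun t : ℝ => t ^ (-κ) * w t) r s =
      sieveInnerProduct b (fun t : ℝ => t ^ (-κ) * w t) r β := by
  rcases eq_or_lt_of_le hs with h | h
  · rw [h]
  · exact eq_of_hasDerivAt_zero_Ioo h (continuousOn_innerProduct_fwd hβ hκβ hrc hwc s)
      fun x hx => hasDerivAt_innerProduct_fwd hβ hbc hrc hrd hwc hwd hx.1

/-- **Value at `β`**: with the constant history `w = A` on `(−∞, β]`,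
`⟨R, r⟩_b(β) = A (β^{1−κ} r(β) − b ∫_{β−1}^{β} r(x+1) x^{−κ} dx)` (Greaves (4.2.4.5)–(4.2.4.7)).
[cite: Greaves2001, (4.2.4.7)] -/
theorem innerProduct_fwd_beta (hwA : ∀ s, s ≤ β → w s = A) :
    sieveInnerProduct b (fun t : ℝ => t ^ (-κ) * w t) r β =
      A * (β * r β * β ^ (-κ) - b * ∫ x in (β - 1)..β, r (x + 1) * x ^ (-κ)) := by
  have hI : ∫ x in (β - 1)..β, r (x + 1) * (x ^ (-κ) * w x) =
      A * ∫ x in (β - 1)..β, r (x + 1) * x ^ (-κ) := by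
    rw [← intervalIntegral.integral_const_mul]
    refine intervalIntegral.integral_congr fun x hx => ?_
    rw [uIcc_of_le (by linarith)] at hx
    show r (x + 1) * (x ^ (-κ) * w x) = A * (r (x + 1) * x ^ (-κ))
    rw [hwA x hx.2]
    ring
  simp only [sieveInnerProduct]
  rw [hwA β le_rfl, hI]
  ring

end Engine

/-! ### Rapid decay of `P − 2` and of `Q` (Diamond–Halberstam–Galway §12.2) -/

section Decay

variable {κ β : ℝ} {w : ℝ → ℝ}

/-- **The constant `2` solves the `P`-relations**: `⟨2, p_κ⟩_{−κ}(s) = 2 (s p_κ(s) + κ ∫_s^{s+1} p_κ) = 2`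
for `s > 0` (Diamond–Halberstam–Galway (12.15); Greaves, proof of Lemma 4.2.6: "the second of
these holds also when `P(s) = 2`"). [cite: DiamondHalberstamGalway2008, (12.15)] -/
theorem sieveInnerProduct_two_p {κ s : ℝ} (hs : 0 < s) :
    s * rosserAdjointP κ s * 2 - (-κ) * ∫ x in (s - 1)..s, rosserAdjointP κ (x + 1) * 2 = 2 := by
  have h := rosserAdjointP_add_integral κ hs
  have hc : ∫ x in (s - 1)..s, rosserAdjointP κ (x + 1) = ∫ t in s..(s + 1), rosserAdjointP κ t := by
    rw [intervalIntegral.integral_comp_add_right (rosserAdjointP κ), sub_add_cancel]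
  rw [intervalIntegral.integral_mul_const, hc]
  linear_combination 2 * h

/-- **The integral inequality for `P − 2`** (Diamond–Halberstam–Galway §12.2; Greaves, proof of
Lemma 4.2.6): if `⟨P, p_κ⟩_{−κ} ≡ 2` on `[β, ∞)` for `P = s^{−κ} w`, then, since `p_κ` is positive
and decreasing, `s |P(s) − 2| ≤ κ ∫_{s−1}^{s} |P(x) − 2| dx` for `s ≥ β + 1`.
[cite: DiamondHalberstamGalway2008, §12.2] -/
theorem integral_ineq_of_innerProduct_p_eq_two (hβ : 1 ≤ β) (hκ : 0 ≤ κ) (hwc : Continuous w)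
    (hP : ∀ s, β ≤ s → sieveInnerProduct (-κ) (fun t : ℝ => t ^ (-κ) * w t) (rosserAdjointP κ) s = 2)
    {s : ℝ} (hs : β + 1 ≤ s) :
    s * |s ^ (-κ) * w s - 2| ≤ κ * ∫ x in (s - 1)..s, |x ^ (-κ) * w x - 2| := by
  have hs0 : 0 < s := by linarith
  have hs1 : 0 < s - 1 := by linarith
  have hp : ContinuousOn (rosserAdjointP κ) (Ioi 0) := continuousOn_rosserAdjointP κ
  have hsub : uIcc (s - 1) s ⊆ Ioi 0 := by
    rw [uIcc_of_le (by linarith)]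
    exact fun x hx => lt_of_lt_of_le hs1 hx.1
  have hgc : ContinuousOn (fun x => rosserAdjointP κ (x + 1) * (x ^ (-κ) * w x)) (uIcc (s - 1) s) :=
    (continuousOn_integrand_fwd hp hwc).mono hsub
  have hp1c : ContinuousOn (fun x => rosserAdjointP κ (x + 1)) (uIcc (s - 1) s) :=
    (continuousOn_comp_add_one hp).mono hsub
  have hφc : ContinuousOn (fun x => x ^ (-κ) * w x - 2) (uIcc (s - 1) s) :=
    ((continuousOn_rpow_neg_mul hwc).mono hsub).sub continuousOn_const
  have e := hP s (by linarith)
  simp only [sieveInnerProduct] at e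
  have t := sieveInnerProduct_two_p (κ := κ) hs0
  have hsplit : ∫ x in (s - 1)..s, rosserAdjointP κ (x + 1) * (x ^ (-κ) * w x - 2) =
      (∫ x in (s - 1)..s, rosserAdjointP κ (x + 1) * (x ^ (-κ) * w x)) -
        ∫ x in (s - 1)..s, rosserAdjointP κ (x + 1) * 2 := by
    have h2c : ContinuousOn (fun x => rosserAdjointP κ (x + 1) * 2) (uIcc (s - 1) s) :=
      hp1c.mul continuousOn_const
    rw [← intervalIntegral.integral_sub hgc.intervalIntegrable h2c.intervalIntegrable]
    refine intervalIntegral.integral_congr fun x _ => ?_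
    ring
  have hid : s * rosserAdjointP κ s * (s ^ (-κ) * w s - 2) =
      -κ * ∫ x in (s - 1)..s, rosserAdjointP κ (x + 1) * (x ^ (-κ) * w x - 2) := by
    rw [hsplit]
    linear_combination e - t
  have hps : 0 < rosserAdjointP κ s := rosserAdjointP.pos hκ hs0
  have hint1 : |∫ x in (s - 1)..s, rosserAdjointP κ (x + 1) * (x ^ (-κ) * w x - 2)| ≤
      ∫ x in (s - 1)..s, |rosserAdjointP κ (x + 1) * (x ^ (-κ) * w x - 2)| :=
    intervalIntegral.abs_integral_le_integral_abs (by linarith)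
  have hint2 : ∫ x in (s - 1)..s, |rosserAdjointP κ (x + 1) * (x ^ (-κ) * w x - 2)| ≤
      ∫ x in (s - 1)..s, rosserAdjointP κ s * |x ^ (-κ) * w x - 2| := by
    refine intervalIntegral.integral_mono_on (by linarith) ((hp1c.mul hφc).abs).intervalIntegrable
      (continuousOn_const.mul hφc.abs).intervalIntegrable fun x hx => ?_
    rw [abs_mul, abs_of_pos (rosserAdjointP.pos hκ (by linarith [hx.1]))]
    refine mul_le_mul_of_nonneg_right ?_ (abs_nonneg _)
    exact rosserAdjointP.antitoneOn hκ (mem_Ioi.mpr hs0) (mem_Ioi.mpr (by linarith [hx.1]))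
      (by linarith [hx.1])
  rw [intervalIntegral.integral_const_mul] at hint2
  have key : rosserAdjointP κ s * (s * |s ^ (-κ) * w s - 2|) ≤
      rosserAdjointP κ s * (κ * ∫ x in (s - 1)..s, |x ^ (-κ) * w x - 2|) := by
    calc rosserAdjointP κ s * (s * |s ^ (-κ) * w s - 2|) = |s * rosserAdjointP κ s * (s ^ (-κ) * w s - 2)| := by
          rw [abs_mul (s * rosserAdjointP κ s), abs_of_pos (mul_pos hs0 hps)]; ring
      _ = κ * |∫ x in (s - 1)..s, rosserAdjointP κ (x + 1) * (x ^ (-κ) * w x - 2)| := by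
          rw [hid, abs_mul, abs_neg, abs_of_nonneg hκ]
      _ ≤ κ * (rosserAdjointP κ s * ∫ x in (s - 1)..s, |x ^ (-κ) * w x - 2|) :=
          mul_le_mul_of_nonneg_left (hint1.trans hint2) hκ
      _ = rosserAdjointP κ s * (κ * ∫ x in (s - 1)..s, |x ^ (-κ) * w x - 2|) := by ring
  exact le_of_mul_le_mul_left key hps

/-- **`P − 2 = O(e^{−s})`** for a forward combination with `⟨P, p_κ⟩_{−κ} ≡ 2` on `[β, ∞)`
(de Bruijn–Hua lemma; Diamond–Halberstam–Galway §12.2, first estimate of (12.7); Greaves,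
Lemma 4.2.6). [cite: DiamondHalberstamGalway2008, §12.2] -/
theorem isBigO_of_innerProduct_p_eq_two (hβ : 1 ≤ β) (hκ : 0 ≤ κ) (hwc : Continuous w)
    (hP : ∀ s, β ≤ s → sieveInnerProduct (-κ) (fun t : ℝ => t ^ (-κ) * w t) (rosserAdjointP κ) s = 2) :
    (fun s : ℝ => s ^ (-κ) * w s - 2) =O[atTop] fun s => Real.exp (-s) := by
  refine isBigO_exp_neg_of_delay_ineq (s₀ := β + 1) (M := κ) ?_
    fun s hs => integral_ineq_of_innerProduct_p_eq_two hβ hκ hwc hP hs.le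
  have : ContinuousOn (fun s : ℝ => s ^ (-κ) * w s - 2) (Ioi 0) :=
    (continuousOn_rpow_neg_mul hwc).sub continuousOn_const
  exact this.mono fun x hx => show (0 : ℝ) < x by simp only [mem_Ioi] at hx; linarith

/-- **The integral inequality for `Q`** (Diamond–Halberstam–Galway §12.2; Greaves, proof of
Lemma 4.2.6): if `⟨Q, q_κ⟩_κ ≡ 0` on `[β, ∞)` for `Q = s^{−κ} w`, then, since `q_κ(s) > 0` and
`q_κ(x + 1) ≤ M q_κ(s)` on `[s − 1, s]` for large `s` (`exists_ratio_bound_qFun`),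
`s |Q(s)| ≤ κ M ∫_{s−1}^{s} |Q(x)| dx` for all large `s`. [cite: DiamondHalberstamGalway2008, §12.2] -/
theorem integral_ineq_of_innerProduct_q_eq_zero (hβ : 1 ≤ β) (hκ : 1 / 2 ≤ κ) (hwc : Continuous w)
    (hQ : ∀ s, β ≤ s → sieveInnerProduct κ (fun t : ℝ => t ^ (-κ) * w t) (qFun κ) s = 0) :
    ∃ s₀ M : ℝ, β + 1 ≤ s₀ ∧ ∀ s, s₀ ≤ s →
      s * |s ^ (-κ) * w s| ≤ M * ∫ x in (s - 1)..s, |x ^ (-κ) * w x| := by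
  obtain ⟨u₁, -, hq⟩ := exists_ratio_bound_qFun hκ
  refine ⟨max (β + 1) u₁, κ * (3 * (2 : ℝ) ^ (2 * κ - 1)), le_max_left _ _, fun s hs => ?_⟩
  have hsβ : β + 1 ≤ s := (le_max_left _ _).trans hs
  have hsu : u₁ ≤ s := (le_max_right _ _).trans hs
  have hs0 : 0 < s := by linarith
  have hs1 : 0 < s - 1 := by linarith
  have hκ0 : 0 ≤ κ := by linarith
  obtain ⟨hqs, hratio⟩ := hq s hsu
  have hqA : ContinuousOn (qFun κ) (Ioi 0) := continuousOn_qFun κ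
  have hsub : uIcc (s - 1) s ⊆ Ioi 0 := by
    rw [uIcc_of_le (by linarith)]
    exact fun x hx => lt_of_lt_of_le hs1 hx.1
  have hq1c : ContinuousOn (fun x => qFun κ (x + 1)) (uIcc (s - 1) s) :=
    (continuousOn_comp_add_one hqA).mono hsub
  have hφc : ContinuousOn (fun x => x ^ (-κ) * w x) (uIcc (s - 1) s) :=
    (continuousOn_rpow_neg_mul hwc).mono hsub
  have e := hQ s (by linarith)
  simp only [sieveInnerProduct] at e
  have hid : s * qFun κ s * (s ^ (-κ) * w s) =
      κ * ∫ x in (s - 1)..s, qFun κ (x + 1) * (x ^ (-κ) * w x) := by linarith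
  have hint1 : |∫ x in (s - 1)..s, qFun κ (x + 1) * (x ^ (-κ) * w x)| ≤
      ∫ x in (s - 1)..s, |qFun κ (x + 1) * (x ^ (-κ) * w x)| :=
    intervalIntegral.abs_integral_le_integral_abs (by linarith)
  have hint2 : ∫ x in (s - 1)..s, |qFun κ (x + 1) * (x ^ (-κ) * w x)| ≤
      ∫ x in (s - 1)..s, 3 * (2 : ℝ) ^ (2 * κ - 1) * qFun κ s * |x ^ (-κ) * w x| := by
    refine intervalIntegral.integral_mono_on (by linarith) ((hq1c.mul hφc).abs).intervalIntegrable
      (continuousOn_const.mul hφc.abs).intervalIntegrable fun x hx => ?_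
    obtain ⟨h0, h1⟩ := hratio x hx
    rw [abs_mul, abs_of_nonneg h0]
    exact mul_le_mul_of_nonneg_right h1 (abs_nonneg _)
  rw [intervalIntegral.integral_const_mul] at hint2
  have key : qFun κ s * (s * |s ^ (-κ) * w s|) ≤
      qFun κ s * (κ * (3 * (2 : ℝ) ^ (2 * κ - 1)) * ∫ x in (s - 1)..s, |x ^ (-κ) * w x|) := by
    calc qFun κ s * (s * |s ^ (-κ) * w s|) = |s * qFun κ s * (s ^ (-κ) * w s)| := by
          rw [abs_mul (s * qFun κ s), abs_of_pos (mul_pos hs0 hqs)]; ring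
      _ = κ * |∫ x in (s - 1)..s, qFun κ (x + 1) * (x ^ (-κ) * w x)| := by
          rw [hid, abs_mul, abs_of_nonneg hκ0]
      _ ≤ κ * (3 * (2 : ℝ) ^ (2 * κ - 1) * qFun κ s * ∫ x in (s - 1)..s, |x ^ (-κ) * w x|) :=
          mul_le_mul_of_nonneg_left (hint1.trans hint2) hκ0
      _ = qFun κ s * (κ * (3 * (2 : ℝ) ^ (2 * κ - 1)) * ∫ x in (s - 1)..s, |x ^ (-κ) * w x|) := by
          ring
  exact le_of_mul_le_mul_left key hqs

/-- **`Q = O(e^{−s})`** for a forward combination with `⟨Q, q_κ⟩_κ ≡ 0` on `[β, ∞)`, `κ ≥ 1/2`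
(de Bruijn–Hua lemma; Diamond–Halberstam–Galway §12.2, second estimate of (12.7); Greaves,
Lemma 4.2.6). [cite: DiamondHalberstamGalway2008, §12.2] -/
theorem isBigO_of_innerProduct_q_eq_zero (hβ : 1 ≤ β) (hκ : 1 / 2 ≤ κ) (hwc : Continuous w)
    (hQ : ∀ s, β ≤ s → sieveInnerProduct κ (fun t : ℝ => t ^ (-κ) * w t) (qFun κ) s = 0) :
    (fun s : ℝ => s ^ (-κ) * w s) =O[atTop] fun s => Real.exp (-s) := by
  obtain ⟨s₀, M, hs₀, h⟩ := integral_ineq_of_innerProduct_q_eq_zero hβ hκ hwc hQ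
  refine isBigO_exp_neg_of_delay_ineq (s₀ := s₀) (M := M) ?_ fun s hs => h s hs.le
  exact (continuousOn_rpow_neg_mul hwc).mono fun x hx => show (0 : ℝ) < x by
    simp only [mem_Ioi] at hx; linarith

end Decay

/-! ### The normalised forward solution -/

section Existence

variable {κ β A : ℝ}

/-- **The boundary constants at `β`.** `⟨P, p_κ⟩_{−κ}(β) = A · C_P` with
`C_P = β^{1−κ} p_κ(β) + κ ∫_{β−1}^{β} p_κ(x+1) x^{−κ} dx > 0` (for `β > 1` this is
`(β − 1)^{1−κ} p_κ(β − 1)`, Greaves (4.2.4.7), (4.2.4.11)). [cite: Greaves2001, (4.2.4.7)] -/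
theorem boundaryConst_upper_pos (hβ : 1 ≤ β) (hκ : 0 ≤ κ) :
    0 < β * rosserAdjointP κ β * β ^ (-κ) - (-κ) * ∫ x in (β - 1)..β, rosserAdjointP κ (x + 1) * x ^ (-κ) := by
  have hβ0 : 0 < β := by linarith
  have h1 : 0 < β * rosserAdjointP κ β * β ^ (-κ) :=
    mul_pos (mul_pos hβ0 (rosserAdjointP.pos hκ hβ0)) (Real.rpow_pos_of_pos hβ0 _)
  have h2 : 0 ≤ ∫ x in (β - 1)..β, rosserAdjointP κ (x + 1) * x ^ (-κ) :=
    intervalIntegral.integral_nonneg (by linarith) fun x hx =>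
      mul_nonneg (rosserAdjointP.pos hκ (by linarith [hx.1])).le (Real.rpow_nonneg (by linarith [hx.1]) _)
  have h3 : 0 ≤ κ * ∫ x in (β - 1)..β, rosserAdjointP κ (x + 1) * x ^ (-κ) := mul_nonneg hκ h2
  linarith

/-- **The `Q`-boundary constant for `β > 1`**: `β^{1−κ} q_κ(β) − κ ∫_{β−1}^{β} q_κ(x+1) x^{−κ} dx`
`= (β − 1)^{1−κ} q_κ(β − 1)` (Greaves, Lemma 4.2.1 (ii) and (4.2.4.7) with `B = 0`;
`sieveInnerProduct_eq` of `SieveAdjoint` applied to the forward combination with `A = 1`), so that it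
vanishes exactly when `q_κ(β − 1) = 0`. [cite: Greaves2001, (4.2.4.7)] -/
theorem boundaryConst_lower_eq (hβ : 1 < β) :
    β * qFun κ β * β ^ (-κ) - κ * ∫ x in (β - 1)..β, qFun κ (x + 1) * x ^ (-κ) =
      (β - 1) ^ (1 - κ) * qFun κ (β - 1) := by
  have hβ1 : 1 ≤ β := hβ.le
  have hκβ : β = 1 → κ < 1 := fun h => absurd h (ne_of_gt hβ)
  have h1 := innerProduct_fwd_beta (κ := κ) (β := β) (A := 1) (b := κ) (r := qFun κ)
    (w := fwdQ κ β 1) fun s hs => fwdQ_of_le hs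
  have h2 := sieveInnerProduct_eq (a := κ) (b := κ) (A := 1) (R := fun t : ℝ => t ^ (-κ) * fwdQ κ β 1 t)
    hβ (isSieveAdjoint_qFun κ) (continuousOn_rpow_neg_mul (continuous_fwdQ hβ1 hκβ))
    (fun x hx => by
      show x ^ (-κ) * fwdQ κ β 1 x = 1 * x ^ (-κ)
      rw [fwdQ_of_le hx.2]; ring)
    (fun t ht _ => by
      have ht0 : 0 < t := by linarith
      have hd := hasDerivAt_fwdQ (A := (1 : ℝ)) hβ1 hκβ ht
      refine (hd.congr_of_eventuallyEq
        (rpow_mul_rpow_neg_mul_eventuallyEq (κ := κ) (fwdQ κ β 1) ht0)).congr_deriv ?_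
      rw [sieveKernel_mul]
      ring)
    le_rfl
  rw [h1] at h2
  linarith

/-- **Sufficiency** (Greaves, Lemma 4.2.6 with Lemma 4.2.5; Diamond–Halberstam–Galway §12.2):
let `κ ≥ 1/2`, `β ≥ 1` (with `κ < 1` if `β = 1`), `A > 0`; suppose the `Q`-boundary constant
vanishes and `A` times the `P`-boundary constant is `2`. Then the forward solution
`(fwdUpper κ β A, fwdLower κ β A)` is a NORMALISED solution: `⟨Q, q_κ⟩_κ ≡ 0` and `⟨P, p_κ⟩_{−κ} ≡ 2`
on `[β, ∞)` by constancy of the inner products, whence `Q = O(e^{−s})`, `P − 2 = O(e^{−s})` by the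
de Bruijn–Hua lemma, i.e. `F, f = 1 + O(e^{−s})`. [cite: Greaves2001, Lemma 4.2.6] -/
theorem isBetaSieveSolution_fwd (hκ : 1 / 2 ≤ κ) (hβ : 1 ≤ β) (hκβ : β = 1 → κ < 1)
    (hA : 0 < A)
    (hCQ : β * qFun κ β * β ^ (-κ) - κ * ∫ x in (β - 1)..β, qFun κ (x + 1) * x ^ (-κ) = 0)
    (hCP : A * (β * rosserAdjointP κ β * β ^ (-κ) - (-κ) * ∫ x in (β - 1)..β, rosserAdjointP κ (x + 1) * x ^ (-κ))
      = 2) :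
    IsBetaSieveSolution κ (fwdUpper κ β A) (fwdLower κ β A) β A := by
  have hκ0 : 0 ≤ κ := by linarith
  obtain ⟨hF0, hf0, hFd, hfd, hFc, hfc⟩ := fwd_spec (κ := κ) (β := β) (A := A) hβ hκβ
  have hP : ∀ s, β ≤ s →
      sieveInnerProduct (-κ) (fun t : ℝ => t ^ (-κ) * fwdP κ β A t) (rosserAdjointP κ) s = 2 := by
    intro s hs
    rw [innerProduct_fwd_eq hβ hκβ (b := -κ) (c := 1) (by ring) (continuousOn_rosserAdjointP κ)
      (fun s hs => hasDerivAt_mul_rosserAdjointP κ hs) (continuous_fwdP hβ hκβ)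
      (fun s hs => by simpa only [one_mul] using hasDerivAt_fwdP hβ hκβ hs) hs,
      innerProduct_fwd_beta fun s hs => fwdP_of_le hs]
    exact hCP
  have hQ : ∀ s, β ≤ s →
      sieveInnerProduct κ (fun t : ℝ => t ^ (-κ) * fwdQ κ β A t) (qFun κ) s = 0 := by
    intro s hs
    rw [innerProduct_fwd_eq hβ hκβ (b := κ) (c := -1) (by ring) (continuousOn_qFun κ)
      (fun s hs => hasDerivAt_mul_qFun κ hs) (continuous_fwdQ hβ hκβ)
      (fun s hs => by simpa only [neg_one_mul] using hasDerivAt_fwdQ hβ hκβ hs) hs,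
      innerProduct_fwd_beta fun s hs => fwdQ_of_le hs, hCQ, mul_zero]
  have hPO := isBigO_of_innerProduct_p_eq_two hβ hκ0 (continuous_fwdP hβ hκβ) hP
  have hQO := isBigO_of_innerProduct_q_eq_zero hβ hκ (continuous_fwdQ hβ hκβ) hQ
  refine ⟨hβ, hA, hF0, hf0, hFd, hfd, hFc, hfc, ?_, ?_⟩
  · refine ((hPO.add hQO).const_mul_left (1 / 2)).congr_left fun s => ?_
    have h1 := fwdUpper_add_fwdLower (κ := κ) (β := β) (A := A) s
    have h2 := fwdUpper_sub_fwdLower (κ := κ) (β := β) (A := A) s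
    simp only [fwdP, fwdQ] at h1 h2 ⊢
    linear_combination (-(1 / 2 : ℝ)) * h1 + (-(1 / 2 : ℝ)) * h2
  · refine ((hPO.sub hQO).const_mul_left (1 / 2)).congr_left fun s => ?_
    have h1 := fwdUpper_add_fwdLower (κ := κ) (β := β) (A := A) s
    have h2 := fwdUpper_sub_fwdLower (κ := κ) (β := β) (A := A) s
    simp only [fwdP, fwdQ] at h1 h2 ⊢
    linear_combination (-(1 / 2 : ℝ)) * h1 + (1 / 2 : ℝ) * h2

/-- **A normalised solution exists as soon as the `Q`-boundary constant vanishes**: choose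
`A = 2 / C_P` (Greaves, Lemma 4.2.5: `C = 2(β − 1)^{κ−1}/p(β − 1)` when `β > 1`).
[cite: Greaves2001, Lemma 4.2.5] -/
theorem exists_isBetaSieveSolution_of_boundaryConst (hκ : 1 / 2 ≤ κ) (hβ : 1 ≤ β)
    (hκβ : β = 1 → κ < 1)
    (hCQ : β * qFun κ β * β ^ (-κ) - κ * ∫ x in (β - 1)..β, qFun κ (x + 1) * x ^ (-κ) = 0) :
    ∃ F f : ℝ → ℝ, ∃ A : ℝ, IsBetaSieveSolution κ F f β A := by
  have hCP := boundaryConst_upper_pos (κ := κ) hβ (by linarith)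
  set C := β * rosserAdjointP κ β * β ^ (-κ) - (-κ) * ∫ x in (β - 1)..β, rosserAdjointP κ (x + 1) * x ^ (-κ)
  exact ⟨_, _, 2 / C, isBetaSieveSolution_fwd hκ hβ hκβ (div_pos two_pos hCP) hCQ
    (div_mul_cancel₀ 2 hCP.ne')⟩

/-- **Sufficiency at a zero of `q_κ`** (Greaves, Lemmas 4.2.5–4.2.6; Diamond–Halberstam–Galway
§12.2): for `κ > 1/2` and every positive zero `ρ` of `q_κ` there is a normalised solution of the
`β`-sieve system with `β = 1 + ρ`. (Iwaniec's `β_κ` uses the greatest zero; the construction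
works for every zero.) [cite: Greaves2001, Lemma 4.2.6] -/
theorem exists_isBetaSieveSolution_of_qFun_eq_zero (hκ : 1 / 2 < κ) {ρ : ℝ} (hρ : 0 < ρ)
    (h0 : qFun κ ρ = 0) :
    ∃ F f : ℝ → ℝ, ∃ A : ℝ, IsBetaSieveSolution κ F f (1 + ρ) A := by
  refine exists_isBetaSieveSolution_of_boundaryConst hκ.le (by linarith)
    (fun h => absurd h (by linarith)) ?_
  rw [boundaryConst_lower_eq (by linarith), add_sub_cancel_left, h0, mul_zero]

/-- **Sufficiency for `κ = 1/2` at `β = 1`** (Greaves, Lemma 4.2.5 (ii) and (4.2.4.17): `q_{1/2} = 1`,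
`B = 0`, `β_{1/2} = 1`): the `Q`-boundary constant is `1 − (1/2) ∫_0^1 x^{−1/2} dx = 0`.
[cite: Greaves2001, Lemma 4.2.5 (ii)] -/
theorem exists_isBetaSieveSolution_half :
    ∃ F f : ℝ → ℝ, ∃ A : ℝ, IsBetaSieveSolution (1 / 2) F f 1 A := by
  refine exists_isBetaSieveSolution_of_boundaryConst le_rfl le_rfl (fun _ => by norm_num) ?_
  have hI : ∫ x in ((1 : ℝ) - 1)..1, qFun (1 / 2) (x + 1) * x ^ (-(1 / 2 : ℝ)) = 2 := by
    simp only [qFun_half, one_mul, sub_self]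
    rw [integral_rpow (Or.inl (by norm_num))]
    have h0 : (0 : ℝ) ^ (-(1 / 2 : ℝ) + 1) = 0 := Real.zero_rpow (by norm_num)
    rw [h0, Real.one_rpow]
    norm_num
  rw [hI, qFun_half, Real.one_rpow]
  norm_num

/-- **Existence of a normalised solution for every `κ ≥ 1/2`** (Iwaniec 1980, §§3–4; Greaves,
Proposition 4.2.1 with Lemmas 4.2.5–4.2.6): at `β = 1` for `κ = 1/2`, and at `β = 1 + ρ` for a
positive zero `ρ` of `q_κ` (which exists, `exists_zero_qFun`) for `κ > 1/2`.
[cite: Greaves2001, Proposition 4.2.1] -/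
theorem exists_isBetaSieveSolution (hκ : 1 / 2 ≤ κ) :
    ∃ (F f : ℝ → ℝ) (β A : ℝ), IsBetaSieveSolution κ F f β A := by
  rcases eq_or_lt_of_le hκ with h | h
  · subst h
    obtain ⟨F, f, A, hS⟩ := exists_isBetaSieveSolution_half
    exact ⟨F, f, 1, A, hS⟩
  · obtain ⟨ρ, hρ, h0⟩ := exists_zero_qFun h
    obtain ⟨F, f, A, hS⟩ := exists_isBetaSieveSolution_of_qFun_eq_zero h hρ h0
    exact ⟨F, f, 1 + ρ, A, hS⟩

end Existence

end BetaSieveForward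

/-! ### The admissible parameters and the discharge of `exists_isBetaSieveData` -/

/-- **The admissible sifting parameters form a finite set**: by the necessary condition
(`IsBetaSieveSolution.adjoint_apply_eq_zero` of `SieveAdjoint`) an admissible `β` is `1` or `1 + ρ`
with `ρ` a positive zero of `q_κ`, and `q_κ` has finitely many positive zeros (Greaves,
Lemma 4.2.3 (i)). [cite: Greaves2001, Lemma 4.2.3 (i)] -/
theorem finite_setOf_isBetaSieveSolution {κ : ℝ} (hκ : 0 ≤ κ) :
    {β : ℝ | ∃ F f : ℝ → ℝ, ∃ A : ℝ, IsBetaSieveSolution κ F f β A}.Finite := by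
  refine (((finite_zeros_qFun hκ).image fun ρ => 1 + ρ).insert 1).subset ?_
  rintro β ⟨F, f, A, h⟩
  refine mem_insert_iff.mpr ?_
  rcases eq_or_lt_of_le h.one_le with h1 | h1
  · exact Or.inl h1.symm
  · exact Or.inr ⟨β - 1, ⟨by linarith, h.qFun_beta_sub_one_eq_zero hκ h1⟩, by ring⟩

/-- **The `β`-sieve functions exist** — discharge of the named fact `exists_isBetaSieveData` of
`SieveFunctions.lean` (Iwaniec, *Rosser's sieve*, Acta Arith. 36 (1980), §§3–4; Greaves,
Proposition 4.2.1, Lemmas 4.2.1–4.2.7): for every `κ ≥ 1/2` the set of admissible parameters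
`β` (those carrying a normalised continuous solution) is nonempty (`exists_isBetaSieveSolution`)
and finite (`finite_setOf_isBetaSieveSolution`), so it has a least element, and a normalised
solution at that least `β` is `β`-sieve data in the sense of `IsBetaSieveData`. (As recorded in
the Correction section of `SieveFunctions.lean`, this least `β` is Iwaniec's `β_κ` for
`κ ∈ {1/2, 1}` but not in
general: Iwaniec's `β_κ` is the GREATEST admissible parameter.) [cite: IwaniecActaArith1980, §§3–4] -/
theorem exists_isBetaSieveData_holds : exists_isBetaSieveData := by
  intro κ hκ
  have hfin := finite_setOf_isBetaSieveSolution (κ := κ) (by linarith)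
  obtain ⟨F, f, β, A, h⟩ := exists_isBetaSieveSolution hκ
  obtain ⟨β₀, ⟨F₀, f₀, A₀, h₀⟩, hmin⟩ :=
    Set.exists_min_image _ id hfin ⟨β, F, f, A, h⟩
  exact ⟨(F₀, f₀, β₀, A₀), h₀, fun F' f' β' A' h' => hmin β' ⟨F', f', A', h'⟩⟩

/-- **Iwaniec's `β`-sieve functions exist** — discharge of the named fact
`exists_isGreatestBetaSieveData` of `SieveFunctions.lean` (the faithful, greatest-`β` pin of
Iwaniec's data; Iwaniec 1980, Thm 1; Greaves (4.2.4.10): `β_κ = 1 +` the greatest zero of `q_κ`):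
the admissible set is nonempty and finite, so it also has a GREATEST element.
[cite: Greaves2001, (4.2.4.10)] -/
theorem exists_isGreatestBetaSieveData_holds : exists_isGreatestBetaSieveData := by
  intro κ hκ
  have hfin := finite_setOf_isBetaSieveSolution (κ := κ) (by linarith)
  obtain ⟨F, f, β, A, h⟩ := exists_isBetaSieveSolution hκ
  obtain ⟨β₀, ⟨F₀, f₀, A₀, h₀⟩, hmax⟩ :=
    Set.exists_max_image _ id hfin ⟨β, F, f, A, h⟩
  exact ⟨(F₀, f₀, β₀, A₀), h₀, fun F' f' β' A' h' => hmax β' ⟨F', f', A', h'⟩⟩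

/-- **Classification of the admissible parameters**: an admissible `β` of dimension `κ ≥ 0` is
`1`, or `β > 1` with `q_κ(β − 1) = 0` (the necessary condition of `SieveAdjoint`
applied to `q_κ`; Greaves (4.2.4.7) with `B = 0`). [cite: Greaves2001, (4.2.4.7)] -/
theorem IsBetaSieveSolution.beta_eq_one_or_qFun_eq_zero {κ : ℝ} {F f : ℝ → ℝ} {β A : ℝ}
    (h : IsBetaSieveSolution κ F f β A) (hκ : 0 ≤ κ) : β = 1 ∨ (1 < β ∧ qFun κ (β - 1) = 0) := by
  rcases eq_or_lt_of_le h.one_le with h1 | h1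
  · exact Or.inl h1.symm
  · exact Or.inr ⟨h1, h.qFun_beta_sub_one_eq_zero hκ h1⟩

/-! ### Corollaries: unconditional forms of the conditional lemmas of `SieveFunctionsBridge` -/

/-- **`β_{1/2} = 1`** for the least-`β` pin (Greaves (4.2.4.10), (4.2.4.17)), unconditionally.
(`β_1 = 2`, i.e. the named fact `siftingLimit_one`, is `siftingLimit_one_holds` of
`LinearSieveExistence.lean`; it also follows as `siftingLimit_one_of_exists exists_isBetaSieveData_holds`.)
[cite: Greaves2001, (4.2.4.10)] -/
theorem siftingLimit_half : siftingLimit (1 / 2) = 1 :=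
  (isBetaSieveSolution_upperSieveFun_lowerSieveFun exists_isBetaSieveData_holds le_rfl).beta_eq_one

/-- The `Classical.epsilon`-chosen least-`β` data are `β`-sieve data for every `κ ≥ 1/2`,
unconditionally. [folklore] -/
theorem isBetaSieveData_betaSieveData' {κ : ℝ} (hκ : 1 / 2 ≤ κ) :
    IsBetaSieveData κ (betaSieveData κ) :=
  isBetaSieveData_betaSieveData exists_isBetaSieveData_holds hκ

/-- The `Classical.epsilon`-chosen greatest-`β` data (Iwaniec's pin) are greatest `β`-sieve data for
every `κ ≥ 1/2`, unconditionally. [folklore] -/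
theorem isGreatestBetaSieveData_greatestBetaSieveData' {κ : ℝ} (hκ : 1 / 2 ≤ κ) :
    IsGreatestBetaSieveData κ (greatestBetaSieveData κ) :=
  isGreatestBetaSieveData_greatestBetaSieveData exists_isGreatestBetaSieveData_holds hκ

/-- `BetaSieveFunctions κ` is nonempty for every `κ ≥ 1/2`, unconditionally. [folklore] -/
theorem BetaSieveFunctions.nonempty' {κ : ℝ} (hκ : 1 / 2 ≤ κ) : Nonempty (BetaSieveFunctions κ) :=
  BetaSieveFunctions.nonempty exists_isBetaSieveData_holds hκ

/-- **`β_{1/2} = 1` for Iwaniec's (greatest-`β`) pin**, unconditionally (`iwaniecSiftingLimit_half` of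
`SieveFunctionsBridge` fed with `exists_isGreatestBetaSieveData_holds`). [cite: Greaves2001, (4.2.4.10)] -/
theorem iwaniecSiftingLimit_half_holds : iwaniecSiftingLimit (1 / 2) = 1 :=
  iwaniecSiftingLimit_half exists_isGreatestBetaSieveData_holds

/-- **`siftingLimit κ ≤ iwaniecSiftingLimit κ`** for every `κ ≥ 1/2`, unconditionally
(`siftingLimit_le_iwaniecSiftingLimit` of `SieveFunctionsBridge`); strict for `κ = 3/2`
(`siftingLimit_three_halves_lt`). [folklore] -/
theorem siftingLimit_le_iwaniecSiftingLimit' {κ : ℝ} (hκ : 1 / 2 ≤ κ) :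
    siftingLimit κ ≤ iwaniecSiftingLimit κ :=
  siftingLimit_le_iwaniecSiftingLimit exists_isBetaSieveData_holds exists_isGreatestBetaSieveData_holds hκ

/-! ### Dimension `3/2`: the least admissible `β` is NOT Iwaniec's `β_{3/2}` -/

namespace BetaSieveForward

/-- **A normalised solution of dimension `3/2` at the SMALLER zero**: `q_{3/2}` vanishes at
`ρ = (3 − √3)/2`, so there is a normalised solution with `β = (5 − √3)/2 = 1.6339…`, strictly
below Iwaniec's `β_{3/2} = 1 + ρ_{3/2} = (5 + √3)/2 = 3.3660…` (Diamond–Halberstam–Galway,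
Table 15.2: `ρ_{1.5} = 2.3660`; Greaves (4.2.4.10)). [cite: DiamondHalberstamGalway2008, Table 15.2] -/
theorem exists_isBetaSieveSolution_three_halves :
    ∃ F f : ℝ → ℝ, ∃ A : ℝ, IsBetaSieveSolution (3 / 2) F f ((5 - Real.sqrt 3) / 2) A := by
  have h3 : Real.sqrt 3 ^ 2 = 3 := Real.sq_sqrt (by norm_num)
  have hlt : Real.sqrt 3 < 2 := by nlinarith [Real.sqrt_nonneg 3]
  have hρ : 0 < (3 - Real.sqrt 3) / 2 := by linarith
  have h0 : qFun (3 / 2) ((3 - Real.sqrt 3) / 2) = 0 := by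
    rw [qFun_three_halves]
    linear_combination (1 / 4 : ℝ) * h3
  rw [show (5 - Real.sqrt 3) / 2 = 1 + (3 - Real.sqrt 3) / 2 by ring]
  exact exists_isBetaSieveSolution_of_qFun_eq_zero (by norm_num) hρ h0

/-- **Iwaniec's solution of dimension `3/2`**: `q_{3/2}` vanishes at its greatest zero
`ρ_{3/2} = (3 + √3)/2 = 2.3660…` (Diamond–Halberstam–Galway, Table 15.2), so there is a normalised
solution with `β = β_{3/2} = (5 + √3)/2`. [cite: DiamondHalberstamGalway2008, Table 15.2] -/
theorem exists_isBetaSieveSolution_three_halves' :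
    ∃ F f : ℝ → ℝ, ∃ A : ℝ, IsBetaSieveSolution (3 / 2) F f ((5 + Real.sqrt 3) / 2) A := by
  have h3 : Real.sqrt 3 ^ 2 = 3 := Real.sq_sqrt (by norm_num)
  have hρ : 0 < (3 + Real.sqrt 3) / 2 := by linarith [Real.sqrt_nonneg 3]
  have h0 : qFun (3 / 2) ((3 + Real.sqrt 3) / 2) = 0 := by
    rw [qFun_three_halves]
    linear_combination (1 / 4 : ℝ) * h3
  rw [show (5 + Real.sqrt 3) / 2 = 1 + (3 + Real.sqrt 3) / 2 by ring]
  exact exists_isBetaSieveSolution_of_qFun_eq_zero (by norm_num) hρ h0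

end BetaSieveForward

/-- **`siftingLimit (3/2) = (5 − √3)/2`, not Iwaniec's `β_{3/2} = (5 + √3)/2`.** The
least-`β` convention of `IsBetaSieveData` (hence of `siftingLimit`, `upperSieveFun`,
`lowerSieveFun`) selects, for `κ = 3/2`, the normalised solution at the smaller zero of
`q_{3/2}` (`exists_isBetaSieveSolution_three_halves` and
`IsBetaSieveSolution.beta_eq_of_three_halves` of `SieveAdjoint`), whereas the literature's sifting
limit is
`β_{3/2} = 1 + ρ_{3/2} = 3.3660…` (`ρ_{1.5} = 2.3660`, the greatest zero of `q_{3/2}`,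
Diamond–Halberstam–Galway Table 15.2, and `β = 1 +` greatest zero, Greaves (4.2.4.10); Table 15.3
of Diamond–Halberstam–Galway lists `ρ_κ + 1` as the Rosser–Iwaniec sifting limit). This makes the
discrepancy recorded in the Correction section of `SieveFunctions.lean` a theorem.
[cite: Greaves2001, (4.2.4.10)] -/
theorem siftingLimit_three_halves : siftingLimit (3 / 2) = (5 - Real.sqrt 3) / 2 := by
  have h := isBetaSieveData_betaSieveData' (κ := 3 / 2) (by norm_num)
  obtain ⟨F, f, A, hS⟩ := exists_isBetaSieveSolution_three_halves
  have hle : siftingLimit (3 / 2) ≤ (5 - Real.sqrt 3) / 2 := h.2 F f _ A hS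
  rcases (isBetaSieveSolution_upperSieveFun_lowerSieveFun exists_isBetaSieveData_holds
      (by norm_num : (1 : ℝ) / 2 ≤ 3 / 2)).beta_eq_of_three_halves with h1 | h1
  · exact h1
  · exfalso
    have : 0 < Real.sqrt 3 := Real.sqrt_pos.mpr (by norm_num)
    rw [h1] at hle
    linarith

/-- **`β_{3/2} = (5 + √3)/2 = 3.3660…` for Iwaniec's (greatest-`β`) sifting limit**
(Diamond–Halberstam–Galway, Table 15.2: `ρ_{1.5} = 2.3660`; Greaves (4.2.4.10)): the admissible
parameters of dimension `3/2` are exactly `(5 ∓ √3)/2` (`IsBetaSieveSolution.beta_eq_of_three_halves`,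
`exists_isBetaSieveSolution_three_halves`, `exists_isBetaSieveSolution_three_halves'`), and the
greatest is `(5 + √3)/2` — this settles the disjunction `iwaniecSiftingLimit_three_halves` of
`SieveFunctionsBridge`, whose docstring notes that excluding the smaller root needs the existence of a
normalised solution at `(5 + √3)/2`. Together with `siftingLimit_three_halves` this exhibits
`siftingLimit (3/2) < iwaniecSiftingLimit (3/2)`. [cite: DiamondHalberstamGalway2008, Table 15.2] -/
theorem iwaniecSiftingLimit_three_halves_eq : iwaniecSiftingLimit (3 / 2) = (5 + Real.sqrt 3) / 2 := by
  have h := isGreatestBetaSieveData_greatestBetaSieveData exists_isGreatestBetaSieveData_holds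
    (κ := 3 / 2) (by norm_num)
  obtain ⟨F, f, A, hS⟩ := exists_isBetaSieveSolution_three_halves'
  have hge : (5 + Real.sqrt 3) / 2 ≤ iwaniecSiftingLimit (3 / 2) := h.2 F f _ A hS
  rcases (isBetaSieveSolution_iwaniecUpperSieveFun_iwaniecLowerSieveFun
      exists_isGreatestBetaSieveData_holds (by norm_num : (1 : ℝ) / 2 ≤ 3 / 2)).beta_eq_of_three_halves
    with h1 | h1
  · exfalso
    have : 0 < Real.sqrt 3 := Real.sqrt_pos.mpr (by norm_num)
    rw [h1] at hge
    linarith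
  · exact h1

/-- **The two conventions differ**: `siftingLimit (3/2) < iwaniecSiftingLimit (3/2)`. [folklore] -/
theorem siftingLimit_three_halves_lt : siftingLimit (3 / 2) < iwaniecSiftingLimit (3 / 2) := by
  rw [siftingLimit_three_halves, iwaniecSiftingLimit_three_halves_eq]
  have : 0 < Real.sqrt 3 := Real.sqrt_pos.mpr (by norm_num)
  linarith

end Literature.NumberTheory.Sieve
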